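/-
Copyright (c) 2026 the pub-hodgecm-mathlib formalisation cell (harness21).  Prover seat hodgecm-mathlib-K2E3-p25 (g3) (L4 architect), HCML Track B «K2-LIT» ∕ h413
(`stmt-HodgeConjecture-24833`).  NR-1′ «LeThree SWEEP»: the two narrowed Harish-Chandra letters follow from the printed (every-`N`, every-place) letters by restriction.
-/
import Summits.HodgeConjecture.HodgeConjecture.Theorems.K2E3CharLettersLeThreeDefs   -- ★ p861200: hHC₃ ∕ hHCB₃ (and the ★ Literature letters they narrow)
import HarnessLib

/-!
# NR-1′ — the narrowed letters hHC₃ ∕ hHCB₃ from the printed letters hHC ∕ hHCB (restriction)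

Cell `pub/hodgecm-mathlib`, crux H413 = `stmt-HodgeConjecture-24833`, line L4 `stub_StCharTS`; director rulings NR-1′ (s1979) ∕ «GO — LeThree SWEEP» (s1980); architect
memo `K2/K2E3-p25/g3/NR1-narrowing-cone.K2E3-p25-g3.md`.  THEOREMS ONLY; count-neutral helper (`--supports stmt-HodgeConjecture-24833 --as helper`).
Two one-line restrictions: ★ `Ch1.characterLocallyIntegrable → characterLocallyIntegrableLeThree` and ★ `normalizedCharacter_locallyBounded →
normalizedCharacter_locallyBoundedLeThree` (drop the hypotheses `2 ≤ N`, `N ≤ 3`, `∀ w ∣ v, conj • w = w`).  USE (W4 pens): U12 MAIN ED. next keeps its every-`N`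
compositions `charLocInt_of_sigs` ∕ `charLocBdd_of_sigs` as ALTERNATIVE roads to the re-typed tier-0 stubs (`:= characterLocallyIntegrableLeThree_of_full (he hb hc ha)`,
`:= normalizedCharacter_locallyBoundedLeThree_of_full (hf hb hd)`) instead of deleting them; any consumer holding the printed letter feeds a `…LeThree` payer through these.
No new mathematics.

HONEST LABEL: HC_CM is proved only modulo the 7 printed citations (2 remaining named inputs: hLiu418 = `stmt-HodgeConjecture-24832`, h413 = `stmt-HodgeConjecture-24833`)
until rung 0 closes; count-neutral helper; the printed letters are NOT proved here (they are hypotheses).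

## References
* [HarishChandra1999AdmissibleDistributions] Harish-Chandra (notes by S. DeBacker, P. J. Sally), *Admissible Invariant Distributions on Reductive p-adic Groups*, ULS 16 (1999), Thm. 16.3.
* [Rogawski1990] J. D. Rogawski, *Automorphic Representations of Unitary Groups in Three Variables*, Ann. of Math. Stud. 123 (1990), §1.6 p. 5; §12.7 p. 193.
-/

set_option autoImplicit false
set_option linter.dupNamespace false   -- `Summit.HodgeConjecture.HodgeConjecture.…` (D-0017 nested layout; lakefile exemption for Summits)

noncomputable section

open Literature.NumberTheory Literature.NumberTheory.Rogawski1990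
open Summit.HodgeConjecture.HodgeConjecture.Cruxes.H413.K2E3CharLettersLeThreeDefs

namespace Summit.HodgeConjecture.HodgeConjecture.Cruxes.H413.K2E3CharLettersLeThreeOfFull

/-- hHC ⇒ hHC₃: Harish-Chandra's local integrability letter for every `N` and every finite place restricts to the narrowed letter (`2 ≤ N ≤ 3`, `v` non-split).
[cite: HarishChandra1999AdmissibleDistributions, Thm. 16.3 p. 77] [cite: Rogawski1990, §1.6 p. 5] -/
theorem characterLocallyIntegrableLeThree_of_full (h : Ch1.characterLocallyIntegrable) : characterLocallyIntegrableLeThree :=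
  fun L _ _ _ N _ _ H hH hHd v _ => h L N H hH hHd v

/-- hHCB ⇒ hHCB₃: Harish-Chandra's local boundedness letter `|D_G|^{1∕2}·Θ_π` for every `N` and every finite place restricts to the narrowed letter (`2 ≤ N ≤ 3`, `v` non-split).
[cite: HarishChandra1999AdmissibleDistributions, Thm. 16.3 p. 77] [cite: Rogawski1990, §12.7 p. 193] -/
theorem normalizedCharacter_locallyBoundedLeThree_of_full (h : normalizedCharacter_locallyBounded) : normalizedCharacter_locallyBoundedLeThree :=
  fun L _ _ _ N _ _ H hH hHd v _ => h L N H hH hHd v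

end Summit.HodgeConjecture.HodgeConjecture.Cruxes.H413.K2E3CharLettersLeThreeOfFull

end
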